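import Mathlib
import HarnessLib
import Literature.Computability.MetaComplexity.NCIPS

/-!
# Crux `RankDefectRepresentations` (stmt-PneNP-18923), line `phantom-kernel`: stub S2 `stub_theoryToCnf` (THEORY-TO-CNF)

Registered tool stub S2 of the skeleton `Cruxes/RankDefectRepresentations/Lines/phantom_kernel.lean` (lead prover,
2026-08-27).  A pair `(M, U)` — matrix tuple and subspace — VALIDATES a clause `κ` when the clause word `Q_κ(M)`
kills `U`; its width-`w` phantom theory is CONTRADICTORY when every Boolean assignment falsifies some validated
clause of length `≤ w`.  This file turns a contradictory theory into an explicit unsatisfiable CNF: choose one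
falsified validated clause `κ_σ` per assignment `σ`, deduplicate (`Finset.image`), list.  The clauses are
distinct lists of length `≤ w` over the `2n` literals, hence at most `(2n+1)^w ≤ (2n+2)^(w+1)` of them
(injection `κ ↦ (i ↦ κ[i]?) : Fin w → Option (Literal (Fin n))`), the size is `≤ w ·` that, and `U` lies in the
common kernel of their clause words.
HONEST FRAMING: finite bookkeeping; P ≠ NP is not moved; F-N2 is a FRONTIER formal rung.
-/

set_option linter.dupNamespace false -- `Summit.PneNP.PneNP.…`: summit = sub-problem name (D-0017)

namespace Summit.PneNP.PneNP.Theorems.CnfIdealGenLengthRankDefectRepresentationsTheoryToCnf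

open Filter
open Literature.Computability.Complexity
open Literature.Computability.MetaComplexity
open Literature.Computability.MetaComplexity.NCIPS

/-- Lists of length `≤ w` over `α` inject into `Fin w → Option α` by `κ ↦ (i ↦ κ[i]?)`; hence a finset of such
lists has at most `(|α| + 1)^w` elements. [folklore] -/
theorem card_le_pow_of_length_le {α : Type} [Fintype α] [DecidableEq α] (w : ℕ) (S : Finset (List α))
    (hS : ∀ κ ∈ S, κ.length ≤ w) : S.card ≤ (Fintype.card α + 1) ^ w := by
  classical
  let f : List α → (Fin w → Option α) := fun κ i => κ[(i : ℕ)]?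
  have hcard : (Finset.univ : Finset (Fin w → Option α)).card = (Fintype.card α + 1) ^ w := by
    rw [Finset.card_univ, Fintype.card_fun, Fintype.card_option, Fintype.card_fin]
  rw [← hcard]
  refine Finset.card_le_card_of_injOn f (fun κ _ => Finset.mem_univ _) ?_
  intro κ₁ h₁ κ₂ h₂ hf
  have h₁' : κ₁.length ≤ w := hS κ₁ h₁
  have h₂' : κ₂.length ≤ w := hS κ₂ h₂
  apply List.ext_getElem?
  intro i
  by_cases hi : i < w
  · exact congrFun hf ⟨i, hi⟩
  · rw [List.getElem?_eq_none (by omega), List.getElem?_eq_none (by omega)]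

/-- STUB S2 `stub_theoryToCnf` of the line `phantom-kernel` (registered signature, verbatim): a contradictory
width-`w` phantom theory contains an explicit unsatisfiable CNF with `≤ (2n+2)^(w+1)` clauses, size
`≤ (w+1)(2n+2)^(w+1)`, all of whose clause words kill `U`. [folklore] -/
theorem stub_theoryToCnf :
    ∀ (n w : ℕ) (K : Type) [Field K] (d : ℕ) (M : Fin n → Matrix (Fin d) (Fin d) K)
      (U : Submodule K (Fin d → K)),
      (∀ σ : Fin n → Bool, ∃ κ : Clause (Fin n), κ.length ≤ w ∧
        (∀ u ∈ U, (MonoidAlgebra.lift K (Matrix (Fin d) (Fin d) K) (FreeMonoid (Fin n))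
          (FreeMonoid.lift M) (clauseWord K κ)).mulVec u = 0) ∧
        Clause.eval σ κ = false) →
      ∃ φ : CNF (Fin n), ¬ φ.Satisfiable ∧ CNF.numClauses φ ≤ (2 * n + 2) ^ (w + 1) ∧
        CNF.size φ ≤ (w + 1) * (2 * n + 2) ^ (w + 1) ∧
        U ≤ ⨅ κ ∈ φ, LinearMap.ker (Matrix.toLin'
          (MonoidAlgebra.lift K (Matrix (Fin d) (Fin d) K) (FreeMonoid (Fin n)) (FreeMonoid.lift M)
            (clauseWord K κ))) := by
  intro n w K _ d M U h
  classical
  choose κσ hlen hval hfalse using h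
  let S : Finset (Clause (Fin n)) := Finset.univ.image κσ
  refine ⟨S.toList, ?_, ?_, ?_, ?_⟩
  · -- unsatisfiable: `σ` falsifies `κσ σ ∈ S`
    rintro ⟨σ, hσ⟩
    have hmem : κσ σ ∈ S.toList := Finset.mem_toList.mpr (Finset.mem_image_of_mem κσ (Finset.mem_univ σ))
    have hall : (S.toList.all fun c => c.any (Literal.eval σ)) = true := hσ
    rw [List.all_eq_true] at hall
    have h1 := hall _ hmem
    have h2 : (κσ σ).any (Literal.eval σ) = false := hfalse σ
    rw [h2] at h1
    exact Bool.false_ne_true h1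
  · -- number of clauses
    have hS : ∀ κ ∈ S, κ.length ≤ w := by
      intro κ hκ
      obtain ⟨σ, -, rfl⟩ := Finset.mem_image.mp hκ
      exact hlen σ
    calc CNF.numClauses S.toList = S.card := by simp [CNF.numClauses]
      _ ≤ (Fintype.card (Literal (Fin n)) + 1) ^ w := card_le_pow_of_length_le w S hS
      _ = (2 * n + 1) ^ w := by
          simp [Fintype.card_prod, Fintype.card_fin, Fintype.card_bool, Nat.mul_comm]
      _ ≤ (2 * n + 2) ^ w := Nat.pow_le_pow_left (by omega) w
      _ ≤ (2 * n + 2) ^ (w + 1) := Nat.pow_le_pow_right (by omega) (by omega)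
  · -- size
    have hS : ∀ κ ∈ S, κ.length ≤ w := by
      intro κ hκ
      obtain ⟨σ, -, rfl⟩ := Finset.mem_image.mp hκ
      exact hlen σ
    have hcardS : S.card ≤ (2 * n + 2) ^ (w + 1) :=
      calc S.card ≤ (Fintype.card (Literal (Fin n)) + 1) ^ w := card_le_pow_of_length_le w S hS
        _ = (2 * n + 1) ^ w := by
            simp [Fintype.card_prod, Fintype.card_fin, Fintype.card_bool, Nat.mul_comm]
        _ ≤ (2 * n + 2) ^ w := Nat.pow_le_pow_left (by omega) w
        _ ≤ (2 * n + 2) ^ (w + 1) := Nat.pow_le_pow_right (by omega) (by omega)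
    have hsum : (S.toList.map List.length).sum ≤ S.toList.length * w := by
      have := List.sum_le_card_nsmul (S.toList.map List.length) w (by
        intro x hx
        obtain ⟨κ, hκ, rfl⟩ := List.mem_map.mp hx
        exact hS κ (Finset.mem_toList.mp hκ))
      simpa using this
    calc CNF.size S.toList = (S.toList.map List.length).sum := rfl
      _ ≤ S.toList.length * w := hsum
      _ = S.card * w := by rw [Finset.length_toList]
      _ ≤ (2 * n + 2) ^ (w + 1) * (w + 1) := Nat.mul_le_mul hcardS (Nat.le_succ w)
      _ = (w + 1) * (2 * n + 2) ^ (w + 1) := Nat.mul_comm _ _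
  · -- `U` lies in the common kernel
    refine le_iInf fun κ => le_iInf fun hκ => ?_
    intro u hu
    obtain ⟨σ, -, rfl⟩ := Finset.mem_image.mp (Finset.mem_toList.mp hκ)
    rw [LinearMap.mem_ker, Matrix.toLin'_apply]
    exact hval σ u hu

end Summit.PneNP.PneNP.Theorems.CnfIdealGenLengthRankDefectRepresentationsTheoryToCnf
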